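import Summits.QuantumFields.QCD.Theorems.QuarksAsStableActionStableActionBridgeStubRayleighLeOfEigenLe
import Summits.QuantumFields.QCD.Theorems.QuarksAsStableActionStableActionBridgeStubBondKernelStar
import Summits.QuantumFields.QCD.Theorems.HeatSlicedQuarksRobustYangMillsHandoverStubGaugeAverageCore
import HarnessLib

/-!
# Stub `stub_eigen_rayleigh` of line `twisted_trace_transfer`
# for crux `QuarksAsStableAction.StableActionBridge` (item stmt-QuantumFields-9737)

The registered stub `stub_eigen_rayleigh` (sub-goal C1 of step E3, wave 2): **every eigenfunction with
non-zero eigenvalue of the scalarised QCD transfer operator is a regularised CORE wave, and its eigenvalue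
is a Rayleigh quotient of the core.**  E3 realises Lüscher's transfer matrix (Lüscher, CMP 54 (1977); Smit,
*Introduction to Quantum Fields on a Lattice*, §6.5 (6.87)) as the `L²(Haar ⊗ count)` integral operator `A`
on `SU(3)^{E₃} × Finset(modes)` with kernel `k((U,s),(U',s')) = (R(U) B(U,U') R(U'))_{s s'}` (`R` a continuous
pointwise Hermitian square root of `T̂_F = fermionSliceOp`, `B(U,U') = ∫ K_β(U,U'^g) Γ(G_g) dg` the
Gauss-averaged Wilson gauge kernel), while the tree's levels `qcdTransferLevel` are suprema of
`transferRayleigh` over the core `transferCore` of continuous gauge-invariant waves.  The stub: `A φ = λ φ`,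
`λ ≠ 0`, `φ ≠ 0` give `Ψ ∈ transferCore` with `𝔫(Ψ,Ψ) = ‖φ‖² ≠ 0`, `𝔱(Ψ,Ψ) = λ 𝔫(Ψ,Ψ)`, `R(Ψ) = λ`.

Proof.  `Ψ(U)_a := λ⁻¹ ∫ (B(U,U') R(U'))_{a s'} φ(U',s') dρ` (bounded jointly continuous kernel times
`φ ∈ L² ⊆ L¹`) is continuous by dominated convergence, and `(R(U)Ψ(U))_s = λ⁻¹ ∫ k((U,s),·) φ dρ` (finite
sums through the integral), so `φ = RΨ` a.e. by `A φ = λ φ` and the kernel formula.  Gauss law: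
`B(U^h,U') = Γ(G_h) B(U,U')` (`bondKernel_gaugeTransform_left`: `K_β(U^h,U'^g) = K_β(U,U'^{h⁻¹g})` by
`Sketch.gaugeSliceKernel_gaugeTransform`, the substitution `g ↦ hg` — left invariance of the product Haar
measure on the temporal links — and `Γ(G_{hg}) = Γ(G_h)Γ(G_g)`, the landed
`StubGaugeAverageCore.fockGaugeAct_mul`), whence
`Ψ(U^h) = Γ(G_h)Ψ(U)`.  The landed `stub_rayleigh_of_invariant` identifies the `k`-form of `RΨ` with
`transferForm β mq Ψ Ψ` and `∫ Σ_s ‖(RΨ)(U)_s‖² dU` with `fermionWeightForm mq Ψ Ψ`; with `φ = RΨ` a.e.,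
`‖φ‖² = 𝔫(Ψ,Ψ)` (`L2.inner_def` and the unscalarisation `∫ dρ = ∫ dU Σ_s` of the landed
`StubRayleighLeOfEigenLe`) and, slice by slice,
`∫ Σ_s Σ_s' conj(RΨ)_s k (RΨ)_{s'} dU' = Σ_s conj(RΨ)(U)_s (A_kφ)(U,s) = λ Σ_s ‖(RΨ)(U)_s‖²`.
The analysis is done for an abstract bond kernel with continuous entries on a compact `X` (`section
Abstract`), the covariance being a hypothesis of `main_of_bondKernel`, and specialised at the end.  Pure
theorem file (no definitions, no notation); helpers in the sub-namespace `StubEigenRayleigh`.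

[cite: Luscher1977, pp. 283–292] [cite: Smit2023, §4.6 (4.127)–(4.137) and §6.5 (6.87)]
[cite: ReedSimonIV1978, Thm XIII.1]
-/

noncomputable section

namespace Summit.QuantumFields.QCD.Cruxes.StableActionBridge.TwistedTraceTransfer

open MeasureTheory Filter
open scoped InnerProductSpace ComplexConjugate Matrix BigOperators
open Literature.MathematicalPhysics.QuantumFieldTheory Literature.MathematicalPhysics.QuantumLattice
open Literature.Probability.LatticeModels (TorusSite)
open Summit.QuantumFields.QCD.Cruxes.RobustYangMillsHandover.PinTheInfimum (StubGaugeAverageCore.fockGaugeAct_mul)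

namespace StubEigenRayleigh

/-- A finite linear combination of integrals of integrable functions is the integral of the linear
combination. [folklore] -/
theorem sum_mul_integral {α ι : Type*} [MeasurableSpace α] {μ : Measure α} [Fintype ι] (m : ι → ℂ)
    {G : ι → α → ℂ} (hint : ∀ i, Integrable (G i) μ) :
    ∑ i, m i * ∫ x, G i x ∂μ = ∫ x, ∑ i, m i * G i x ∂μ := by
  rw [integral_finsetSum _ fun i _ => (hint i).const_mul (m i)]
  exact Finset.sum_congr rfl fun i _ => (integral_const_mul _ _).symm

/-- The entries of a continuous matrix-valued map on a compact space are uniformly bounded. [folklore] -/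
theorem exists_bound_matrix_entries {P : Type*} [TopologicalSpace P] [CompactSpace P] {m n : Type*}
    [Fintype m] [Fintype n] {M : P → Matrix m n ℂ} (hM : Continuous M) :
    ∃ C : ℝ, ∀ p i j, ‖M p i j‖ ≤ C := by
  letI : NormedAddCommGroup (Matrix m n ℂ) := Matrix.normedAddCommGroup
  obtain ⟨C, hC⟩ := isCompact_univ.exists_bound_of_continuousOn hM.continuousOn
  exact ⟨C, fun p i j => (Matrix.norm_entry_le_entrywise_sup_norm (M p)).trans (hC p (Set.mem_univ p))⟩

/-! ### Left covariance of the Gauss-averaged bond kernel -/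

variable {Nf S : ℕ} [NeZero S]

/-- **Left covariance of the Gauss-averaged bond kernel**, `B(U^h, U') = Γ(G_h) B(U, U')` for
`B(U,U')_{a c} = ∫ K_β(U, U'^g) Γ(G_g)_{a c} dg`: `K_β(U^h, U'^g) = K_β(U, U'^{h⁻¹ g})` (invariance of the
kernel under the simultaneous transformation `h⁻¹`), the substitution `g ↦ h g` (left invariance of the
product Haar measure on the temporal links) and `Γ(G_{h g}) = Γ(G_h) Γ(G_g)`
(`StubGaugeAverageCore.fockGaugeAct_mul`). [cite: Smit2023, §4.6 (4.124)–(4.137)] -/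
theorem bondKernel_gaugeTransform_left (β : ℝ) (h : TorusSite 3 S → Matrix.specialUnitaryGroup (Fin 3) ℂ)
    (U U' : GaugeConfig 3 S (Matrix.specialUnitaryGroup (Fin 3) ℂ)) :
    (Matrix.of fun a c => ∫ g : TorusSite 3 S → Matrix.specialUnitaryGroup (Fin 3) ℂ,
        (gaugeSliceKernel β (gaugeTransform h U) (gaugeTransform g U') : ℂ) * fockGaugeAct (Nf := Nf) g a c
          ∂(Measure.pi fun _ => haarProbability (Matrix.specialUnitaryGroup (Fin 3) ℂ))) =
      fockGaugeAct h * Matrix.of fun a c => ∫ g : TorusSite 3 S → Matrix.specialUnitaryGroup (Fin 3) ℂ,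
        (gaugeSliceKernel β U (gaugeTransform g U') : ℂ) * fockGaugeAct (Nf := Nf) g a c
          ∂(Measure.pi fun _ => haarProbability (Matrix.specialUnitaryGroup (Fin 3) ℂ)) := by
  have hcomp : ∀ g : TorusSite 3 S → Matrix.specialUnitaryGroup (Fin 3) ℂ,
      gaugeTransform h⁻¹ (gaugeTransform g U') = gaugeTransform (h⁻¹ * g) U' := fun g => by
    funext e
    simp only [gaugeTransform, Pi.mul_apply, Pi.inv_apply, mul_inv_rev, mul_assoc]
  have hU : gaugeTransform h⁻¹ (gaugeTransform h U) = U := by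
    simpa only [inv_inv] using StubBondKernelStar.gaugeTransform_gaugeTransform_inv h⁻¹ U
  have hK : ∀ g : TorusSite 3 S → Matrix.specialUnitaryGroup (Fin 3) ℂ,
      gaugeSliceKernel β (gaugeTransform h U) (gaugeTransform g U') =
        gaugeSliceKernel β U (gaugeTransform (h⁻¹ * g) U') := fun g => by
    rw [← Sketch.gaugeSliceKernel_gaugeTransform S β h⁻¹ (gaugeTransform h U) (gaugeTransform g U'), hU,
      hcomp]
  ext a c
  rw [Matrix.mul_apply]
  simp only [Matrix.of_apply, hK]
  rw [← integral_mul_left_eq_self _ h]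
  simp only [inv_mul_cancel_left, StubGaugeAverageCore.fockGaugeAct_mul, Matrix.mul_apply, Finset.mul_sum]
  rw [integral_finsetSum _ fun d _ => ?_]
  · refine Finset.sum_congr rfl fun d _ => ?_
    rw [← integral_const_mul]
    exact integral_congr_ae (Eventually.of_forall fun g => by ring)
  · exact ((StubRayleighOfInvariant.integrable_bondIntegrand β U U' d c).const_mul
      (fockGaugeAct (Nf := Nf) h a d)).congr (Eventually.of_forall fun g => by ring)

/-! ### The wave function of an `L²` function, for an abstract bond kernel

`X` is a compact configuration space, `F` a finite index type, `ρ` a finite measure on `X × F`,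
`R : X → Matrix F F ℂ` continuous and `B : X → X → Matrix F F ℂ` with jointly continuous entries. -/

section Abstract

variable {X : Type*} [TopologicalSpace X] {F : Type*} [Fintype F] {R : X → Matrix F F ℂ} (hRc : Continuous R)
  {B : X → X → Matrix F F ℂ} (hBc : ∀ a c, Continuous fun p : X × X => B p.1 p.2 a c)

include hRc hBc

/-- `(U, U') ↦ B(U,U') R(U')` is continuous. [folklore] -/
theorem continuous_BR : Continuous fun p : X × X => B p.1 p.2 * R p.2 :=
  (continuous_matrix hBc).mul hRc.snd'

/-- `(U, U') ↦ R(U) B(U,U') R(U')` (the scalarised kernel as a matrix) is continuous. [folklore] -/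
theorem continuous_RBR : Continuous fun p : X × X => R p.1 * B p.1 p.2 * R p.2 :=
  (hRc.fst'.mul (continuous_matrix hBc)).mul hRc.snd'

variable [CompactSpace X] [MeasurableSpace X] [OpensMeasurableSpace X] [MeasurableSpace F]
  [MeasurableSingletonClass F] {ρ : Measure (X × F)} [IsFiniteMeasure ρ]

/-- The integrand `(U', s') ↦ (B(U,U') R(U'))_{a s'} φ(U',s')` of the wave function is integrable
(bounded kernel with continuous sections times an `L² ⊆ L¹` function on a finite measure space). [folklore] -/
theorem integrable_bondMul (φ : Lp ℂ 2 ρ) (U : X) (a : F) :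
    Integrable (fun y' : X × F => (B U y'.1 * R y'.1) a y'.2 * φ y') ρ := by
  obtain ⟨C, hC⟩ := exists_bound_matrix_entries (continuous_BR hRc hBc)
  refine ((Lp.memLp φ).integrable one_le_two).bdd_mul ?_ (Eventually.of_forall fun y' => hC (U, y'.1) a y'.2)
  have h := fun s' : F => ((continuous_BR hRc hBc).matrix_elem a s').comp' (Continuous.prodMk_right (Y := X) U)
  exact (measurable_from_prod_countable_left (f := fun y' : X × F => (B U y'.1 * R y'.1) a y'.2)
    fun s' => (h s').measurable).aestronglyMeasurable

/-- **`R Ψ` is the regularised function**: for `Ψ(U)_a = λ⁻¹ ∫ (B(U,U') R(U'))_{a s'} φ(U',s') dρ`,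
`(R(U) Ψ(U))_s = λ⁻¹ ∫ (R(U) B(U,U') R(U'))_{s s'} φ(U',s') dρ` (finite sums through the integral).
[folklore] -/
theorem mulVec_wave (φ : Lp ℂ 2 ρ) {lam : ℝ} {Ψ : X → F → ℂ}
    (hΨ : ∀ U a, Ψ U a = (lam : ℂ)⁻¹ * ∫ y', (B U y'.1 * R y'.1) a y'.2 * φ y' ∂ρ) (U : X) (s : F) :
    (R U *ᵥ Ψ U) s = (lam : ℂ)⁻¹ * ∫ y', (R U * B U y'.1 * R y'.1) s y'.2 * φ y' ∂ρ := by
  have hint := integrable_bondMul hRc hBc φ U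
  calc (R U *ᵥ Ψ U) s
      = ∑ j, R U s j * ((lam : ℂ)⁻¹ * ∫ y', (B U y'.1 * R y'.1) j y'.2 * φ y' ∂ρ) := by
        simp only [Matrix.mulVec, dotProduct, hΨ]
    _ = (lam : ℂ)⁻¹ * ∑ j, R U s j * ∫ y', (B U y'.1 * R y'.1) j y'.2 * φ y' ∂ρ := by
        rw [Finset.mul_sum]
        exact Finset.sum_congr rfl fun j _ => by ring
    _ = (lam : ℂ)⁻¹ * ∫ y', ∑ j, R U s j * ((B U y'.1 * R y'.1) j y'.2 * φ y') ∂ρ := by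
        rw [sum_mul_integral _ hint]
    _ = (lam : ℂ)⁻¹ * ∫ y', (R U * B U y'.1 * R y'.1) s y'.2 * φ y' ∂ρ := by
        congr 1
        refine integral_congr_ae (Eventually.of_forall fun y' => ?_)
        simp only [Matrix.mul_assoc]
        rw [Matrix.mul_apply, Finset.sum_mul]
        simp only [mul_assoc]

/-- **Covariance of the wave function**: if `B(V, ·) = Γ B(U, ·)` then `Ψ(V) = Γ Ψ(U)` (finite sums
through the integral) — the Gauss law of `Ψ` once `B(U^h, ·) = Γ(G_h) B(U, ·)`.
[cite: Smit2023, §4.6 (4.127)–(4.137)] -/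
theorem wave_covariance (φ : Lp ℂ 2 ρ) {lam : ℝ} {Ψ : X → F → ℂ}
    (hΨ : ∀ U a, Ψ U a = (lam : ℂ)⁻¹ * ∫ y', (B U y'.1 * R y'.1) a y'.2 * φ y' ∂ρ)
    {Γ : Matrix F F ℂ} {U V : X} (hBcov : ∀ U', B V U' = Γ * B U U') : Ψ V = Γ *ᵥ Ψ U := by
  have hint := integrable_bondMul hRc hBc φ U
  funext a
  calc Ψ V a = (lam : ℂ)⁻¹ * ∫ y', ∑ c, Γ a c * ((B U y'.1 * R y'.1) c y'.2 * φ y') ∂ρ := by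
        rw [hΨ]
        congr 1
        refine integral_congr_ae (Eventually.of_forall fun y' => ?_)
        simp only [hBcov, Matrix.mul_assoc]
        rw [Matrix.mul_apply, Finset.sum_mul]
        simp only [mul_assoc]
    _ = (lam : ℂ)⁻¹ * ∑ c, Γ a c * ∫ y', (B U y'.1 * R y'.1) c y'.2 * φ y' ∂ρ := by
        rw [sum_mul_integral _ hint]
    _ = (Γ *ᵥ Ψ U) a := by
        simp only [Matrix.mulVec, dotProduct, hΨ U, Finset.mul_sum]
        exact Finset.sum_congr rfl fun c _ => by ring

variable [FirstCountableTopology X]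

/-- **The wave function of an `L²` function is continuous**: `U ↦ ∫ (B(U,U') R(U'))_{a s'} φ(U',s') dρ`
is continuous by dominated convergence (bounded jointly continuous kernel, `φ ∈ L¹`). [folklore] -/
theorem continuous_integral_bondMul (φ : Lp ℂ 2 ρ) (a : F) :
    Continuous fun U : X => ∫ y', (B U y'.1 * R y'.1) a y'.2 * φ y' ∂ρ := by
  obtain ⟨C, hC⟩ := exists_bound_matrix_entries (continuous_BR hRc hBc)
  have hcont := fun y' : X × F =>
    ((continuous_BR hRc hBc).matrix_elem a y'.2).comp' (Continuous.prodMk_left (X := X) y'.1)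
  exact continuous_of_dominated (F := fun (U : X) (y' : X × F) => (B U y'.1 * R y'.1) a y'.2 * φ y')
    (bound := fun y' => C * ‖(φ : X × F → ℂ) y'‖)
    (fun U => (integrable_bondMul hRc hBc φ U a).aestronglyMeasurable)
    (fun U => Eventually.of_forall fun y' => by
      rw [norm_mul]
      exact mul_le_mul_of_nonneg_right (hC (U, y'.1) a y'.2) (norm_nonneg _))
    (((Lp.memLp φ).integrable one_le_two).norm.const_mul C)
    (Eventually.of_forall fun y' => (hcont y').mul continuous_const)

/-- The wave function `Ψ(U)_a = λ⁻¹ ∫ (B(U,U') R(U'))_{a s'} φ(U',s') dρ` is continuous. [folklore] -/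
theorem continuous_wave (φ : Lp ℂ 2 ρ) {lam : ℝ} {Ψ : X → F → ℂ}
    (hΨ : ∀ U a, Ψ U a = (lam : ℂ)⁻¹ * ∫ y', (B U y'.1 * R y'.1) a y'.2 * φ y' ∂ρ) : Continuous Ψ :=
  continuous_pi fun a =>
    (continuous_const.mul (continuous_integral_bondMul hRc hBc φ a)).congr fun U => (hΨ U a).symm

end Abstract

/-- **Eigenfunctions with non-zero eigenvalue are regularised core waves** — the stub for an abstract
bond kernel `B` on the QCD slice with jointly continuous entries and left covariance
`B(U^h,U') = Γ(G_h) B(U,U')`, given the conclusion of `stub_rayleigh_of_invariant` for `B` (`hray`).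
If `A` is given a.e. by `k((U,s),(U',s')) = (R(U) B(U,U') R(U'))_{s s'}` on `L²(Haar ⊗ count)` and
`A φ = λ φ`, `λ ≠ 0`, `φ ≠ 0`, then the wave function `Ψ` of `φ` is in `transferCore`, `R Ψ = φ` a.e.,
`𝔫(Ψ,Ψ) = ‖φ‖² ≠ 0`, `𝔱(Ψ,Ψ) = λ 𝔫(Ψ,Ψ)` and `transferRayleigh β mq Ψ = λ`.
[cite: Luscher1977, pp. 283–292] [cite: ReedSimonIV1978, Thm XIII.1] -/
theorem main_of_bondKernel
    {R : GaugeConfig 3 S (Matrix.specialUnitaryGroup (Fin 3) ℂ) →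
      Matrix (Finset (SliceFermiIdx Nf S)) (Finset (SliceFermiIdx Nf S)) ℂ} (hRc : Continuous R)
    {B : GaugeConfig 3 S (Matrix.specialUnitaryGroup (Fin 3) ℂ) →
      GaugeConfig 3 S (Matrix.specialUnitaryGroup (Fin 3) ℂ) →
      Matrix (Finset (SliceFermiIdx Nf S)) (Finset (SliceFermiIdx Nf S)) ℂ}
    (hBc : ∀ a c, Continuous fun p : GaugeConfig 3 S (Matrix.specialUnitaryGroup (Fin 3) ℂ) ×
      GaugeConfig 3 S (Matrix.specialUnitaryGroup (Fin 3) ℂ) => B p.1 p.2 a c) (β : ℝ) (mq : Fin Nf → ℝ)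
    (hBcov : ∀ h U U', B (gaugeTransform h U) U' = fockGaugeAct h * B U U')
    (hray : ∀ Ψ : SliceWave Nf S, Ψ ∈ transferCore Nf S →
      (∫ U, ∫ U', ∑ s, ∑ s', (starRingEnd ℂ) ((R U *ᵥ Ψ U) s) *
          ((R U * B U U' * R U') s s') * (R U' *ᵥ Ψ U') s'
          ∂(sliceHaar S) ∂(sliceHaar S) = transferForm β mq Ψ Ψ) ∧
      (∫ U, ∑ s, ((‖(R U *ᵥ Ψ U) s‖ ^ 2 : ℝ) : ℂ) ∂(sliceHaar S) = fermionWeightForm mq Ψ Ψ))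
    (k : GaugeConfig 3 S (Matrix.specialUnitaryGroup (Fin 3) ℂ) × Finset (SliceFermiIdx Nf S) →
      GaugeConfig 3 S (Matrix.specialUnitaryGroup (Fin 3) ℂ) × Finset (SliceFermiIdx Nf S) → ℂ)
    (hk : ∀ y y', k y y' = (R y.1 * B y.1 y'.1 * R y'.1) y.2 y'.2)
    (A : Lp ℂ 2 ((sliceHaar S).prod (Measure.count : Measure (Finset (SliceFermiIdx Nf S)))) →L[ℂ]
        Lp ℂ 2 ((sliceHaar S).prod (Measure.count : Measure (Finset (SliceFermiIdx Nf S)))))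
    (hA : ∀ φ : Lp ℂ 2 ((sliceHaar S).prod (Measure.count : Measure (Finset (SliceFermiIdx Nf S)))),
        (A φ : GaugeConfig 3 S (Matrix.specialUnitaryGroup (Fin 3) ℂ) × Finset (SliceFermiIdx Nf S) → ℂ)
          =ᵐ[(sliceHaar S).prod (Measure.count : Measure (Finset (SliceFermiIdx Nf S)))]
          fun y => ∫ y', k y y' * φ y' ∂((sliceHaar S).prod (Measure.count : Measure (Finset (SliceFermiIdx Nf S)))))
    (φ : Lp ℂ 2 ((sliceHaar S).prod (Measure.count : Measure (Finset (SliceFermiIdx Nf S))))) (lam : ℝ)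
    (hlam : lam ≠ 0) (hφ : φ ≠ 0) (hAφ : A φ = (lam : ℂ) • φ) :
    ∃ Ψ : SliceWave Nf S, Ψ ∈ transferCore Nf S ∧ fermionWeightForm mq Ψ Ψ ≠ 0 ∧
        fermionWeightForm mq Ψ Ψ = ((‖φ‖ ^ 2 : ℝ) : ℂ) ∧
        transferForm β mq Ψ Ψ = (lam : ℂ) * fermionWeightForm mq Ψ Ψ ∧
        transferRayleigh β mq Ψ = lam := by
  haveI := Sketch.isProbabilityMeasure_sliceHaar S
  have hlamC : (lam : ℂ) ≠ 0 := Complex.ofReal_ne_zero.mpr hlam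
  have hk2 : ∀ U U' s s', k (U, s) (U', s') = (R U * B U U' * R U') s s' :=
    fun U U' s s' => hk (U, s) (U', s')
  -- the wave function `Ψ` of `φ` and the regularised function `b = R Ψ`
  obtain ⟨Ψ, hΨ⟩ : ∃ Ψ : SliceWave Nf S, ∀ U a, Ψ U a = (lam : ℂ)⁻¹ *
      ∫ y', (B U y'.1 * R y'.1) a y'.2 * φ y' ∂((sliceHaar S).prod Measure.count) := ⟨_, fun _ _ => rfl⟩
  have hcore : Ψ ∈ transferCore Nf S :=
    ⟨continuous_wave hRc hBc φ hΨ, fun h U => wave_covariance hRc hBc φ hΨ (hBcov h U)⟩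
  obtain ⟨b, hb⟩ : ∃ b : _ → ℂ, ∀ U s, b (U, s) = (R U *ᵥ Ψ U) s :=
    ⟨fun y => (R y.1 *ᵥ Ψ y.1) y.2, fun _ _ => rfl⟩
  -- `b = λ⁻¹ A_k φ` pointwise, hence `φ = b` almost everywhere
  have hbI : ∀ y, b y = (lam : ℂ)⁻¹ * ∫ y', k y y' * φ y' ∂((sliceHaar S).prod Measure.count) := by
    rintro ⟨U, s⟩
    rw [hb]
    simp only [hk]
    exact mulVec_wave hRc hBc φ hΨ U s
  have hIb : ∀ y, ∫ y', k y y' * φ y' ∂((sliceHaar S).prod Measure.count) = (lam : ℂ) * b y :=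
    fun y => by rw [hbI, ← mul_assoc, mul_inv_cancel₀ hlamC, one_mul]
  have hae : ∀ᵐ y ∂((sliceHaar S).prod Measure.count), (φ : _ → ℂ) y = b y := by
    have h1 := hA φ
    rw [hAφ] at h1
    filter_upwards [h1, Lp.coeFn_smul (lam : ℂ) φ] with y hy hy'
    rw [hbI, ← hy, hy', Pi.smul_apply, smul_eq_mul, ← mul_assoc, inv_mul_cancel₀ hlamC, one_mul]
  -- continuous sections of `b` and of `k`
  have hbU : ∀ s : Finset (SliceFermiIdx Nf S), Continuous fun U => b (U, s) := fun s => by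
    have h := (continuous_apply s).comp' (hRc.matrix_mulVec hcore.1)
    simp only [hb]
    exact h
  have hkU : ∀ y (s' : Finset (SliceFermiIdx Nf S)), Continuous fun U' => k y (U', s') := fun y s' => by
    have h := ((continuous_RBR hRc hBc).matrix_elem y.2 s').comp'
      (Continuous.prodMk_right (Y := GaugeConfig 3 S (Matrix.specialUnitaryGroup (Fin 3) ℂ)) y.1)
    simp only [hk]
    exact h
  -- `‖φ‖² = ∫ Σ_s ‖b(U,s)‖² dU`
  have hnorm : ((‖φ‖ ^ 2 : ℝ) : ℂ) = ∫ U, ∑ s, ((‖b (U, s)‖ ^ 2 : ℝ) : ℂ) ∂(sliceHaar S) := by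
    have h := inner_self_eq_norm_sq_to_K (𝕜 := ℂ) φ
    rw [L2.inner_def] at h
    simp_rw [inner_self_eq_norm_sq_to_K] at h
    have h1 : ((‖φ‖ ^ 2 : ℝ) : ℂ) = ∫ y, ((‖(φ : _ → ℂ) y‖ ^ 2 : ℝ) : ℂ) ∂((sliceHaar S).prod Measure.count) := by
      exact_mod_cast h.symm
    rw [h1, ← StubRayleighLeOfEigenLe.integral_prod_count (f := fun y => ((‖b y‖ ^ 2 : ℝ) : ℂ))
      fun s => Complex.continuous_ofReal.comp' ((hbU s).norm.pow 2)]
    exact integral_congr_ae (hae.mono fun y hy => by simp only [hy])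
  -- slice by slice: `∫ Σ_s Σ_s' conj b(U,s) k b(U',s') dU' = λ Σ_s ‖b(U,s)‖²`
  have hstep : ∀ U : GaugeConfig 3 S (Matrix.specialUnitaryGroup (Fin 3) ℂ),
      ∫ U', ∑ s, ∑ s', (starRingEnd ℂ) (b (U, s)) * k (U, s) (U', s') * b (U', s') ∂(sliceHaar S) =
        (lam : ℂ) * ∑ s, ((‖b (U, s)‖ ^ 2 : ℝ) : ℂ) := fun U => by
    have hG : ∀ s : Finset (SliceFermiIdx Nf S),
        Integrable (fun U' => ∑ s', k (U, s) (U', s') * b (U', s')) (sliceHaar S) := fun s =>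
      Sketch.integrable_sliceHaar_of_continuous (continuous_finsetSum _ fun s' _ => (hkU (U, s) s').mul (hbU s'))
    calc ∫ U', ∑ s, ∑ s', (starRingEnd ℂ) (b (U, s)) * k (U, s) (U', s') * b (U', s') ∂(sliceHaar S)
        = ∫ U', ∑ s, (starRingEnd ℂ) (b (U, s)) * ∑ s', k (U, s) (U', s') * b (U', s') ∂(sliceHaar S) := by
          refine integral_congr_ae (Eventually.of_forall fun U' => Finset.sum_congr rfl fun s _ => ?_)
          rw [Finset.mul_sum]
          exact Finset.sum_congr rfl fun s' _ => mul_assoc _ _ _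
      _ = ∑ s, (starRingEnd ℂ) (b (U, s)) * ∫ U', ∑ s', k (U, s) (U', s') * b (U', s') ∂(sliceHaar S) :=
          (sum_mul_integral _ hG).symm
      _ = ∑ s, (starRingEnd ℂ) (b (U, s)) * ∫ y', k (U, s) y' * φ y' ∂((sliceHaar S).prod Measure.count) := by
          refine Finset.sum_congr rfl fun s _ => ?_
          rw [← StubRayleighLeOfEigenLe.integral_prod_count (f := fun y' => k (U, s) y' * b y')
            fun s' => (hkU (U, s) s').mul (hbU s')]
          exact congrArg _ (integral_congr_ae (hae.mono fun y' hy' => by simp only [hy']))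
      _ = (lam : ℂ) * ∑ s, ((‖b (U, s)‖ ^ 2 : ℝ) : ℂ) := by
          simp only [hIb, Finset.mul_sum]
          refine Finset.sum_congr rfl fun s _ => ?_
          rw [Complex.ofReal_pow, ← Complex.conj_mul']
          ring
  -- assemble with `stub_rayleigh_of_invariant` (`hray`)
  obtain ⟨h1, h2⟩ := hray Ψ hcore
  have hW : fermionWeightForm mq Ψ Ψ = ((‖φ‖ ^ 2 : ℝ) : ℂ) := by
    rw [← h2, hnorm]
    simp only [hb]
  have hT : transferForm β mq Ψ Ψ = (lam : ℂ) * fermionWeightForm mq Ψ Ψ := by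
    rw [← h1, ← h2, ← integral_const_mul]
    refine integral_congr_ae (Eventually.of_forall fun U => ?_)
    simp only [← hb, ← hk2]
    exact hstep U
  have hnpos : (0 : ℝ) < ‖φ‖ ^ 2 := pow_pos (norm_pos_iff.mpr hφ) 2
  refine ⟨Ψ, hcore, ?_, hW, hT, ?_⟩
  · rw [hW]
    exact_mod_cast hnpos.ne'
  · unfold transferRayleigh
    rw [hT, hW, ← Complex.ofReal_mul, Complex.ofReal_re, Complex.ofReal_re, mul_div_assoc,
      div_self hnpos.ne', mul_one]

end StubEigenRayleigh

open StubEigenRayleigh in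
/-- **Sub-goal C1 of step E3 (registered stub `stub_eigen_rayleigh`): every eigenfunction of the
scalarised QCD transfer operator with non-zero eigenvalue is `R Ψ` for a continuous gauge-invariant
wave `Ψ ∈ transferCore`, and the eigenvalue is the Rayleigh quotient of `Ψ`.**  For the `L²(Haar ⊗ count)`
integral operator `A` of `k((U,s),(U',s')) = (R(U) B(U,U') R(U'))_{s s'}`, `B(U,U') = ∫ K_β(U,U'^g) Γ(G_g) dg`,
`A φ = λ φ` (`λ ≠ 0`, `φ ≠ 0`) yields the continuous gauge-invariant `Ψ(U) = λ⁻¹ ∫ B(U,U') R(U') φ(U',·)`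
with `R Ψ = φ` a.e., `𝔫(Ψ,Ψ) = ‖φ‖² ≠ 0` and `𝔱(Ψ,Ψ) = λ ‖φ‖²` (`StubEigenRayleigh.main_of_bondKernel`).
[cite: Luscher1977, pp. 283–292] [cite: ReedSimonIV1978, Thm XIII.1] -/
theorem stub_eigen_rayleigh : ∀ (Nf S : ℕ) [NeZero S] (β : ℝ) (mq : Fin Nf → ℝ), (∀ f, -1 < mq f) →
    ∀ R : GaugeConfig 3 S (Matrix.specialUnitaryGroup (Fin 3) ℂ) → Matrix (Finset (SliceFermiIdx Nf S)) (Finset (SliceFermiIdx Nf S)) ℂ,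
    Continuous R → (∀ U, (R U)ᴴ = R U ∧ R U * R U = fermionSliceOp U mq) →
    ∀ k : GaugeConfig 3 S (Matrix.specialUnitaryGroup (Fin 3) ℂ) × Finset (SliceFermiIdx Nf S) → GaugeConfig 3 S (Matrix.specialUnitaryGroup (Fin 3) ℂ) × Finset (SliceFermiIdx Nf S) → ℂ,
    (∀ y y', k y y' = (R y.1 * (Matrix.of fun a c => ∫ g : TorusSite 3 S → (Matrix.specialUnitaryGroup (Fin 3) ℂ),
          (gaugeSliceKernel β y.1 (gaugeTransform g y'.1) : ℂ) * @fockGaugeAct Nf S _ g a c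
            ∂(Measure.pi fun _ => haarProbability (Matrix.specialUnitaryGroup (Fin 3) ℂ))) * R y'.1) y.2 y'.2) →
    ∀ A : Lp ℂ 2 ((sliceHaar S).prod (Measure.count : Measure (Finset (SliceFermiIdx Nf S)))) →L[ℂ]
        Lp ℂ 2 ((sliceHaar S).prod (Measure.count : Measure (Finset (SliceFermiIdx Nf S)))),
      (∀ φ : Lp ℂ 2 ((sliceHaar S).prod (Measure.count : Measure (Finset (SliceFermiIdx Nf S)))),
        (A φ : GaugeConfig 3 S (Matrix.specialUnitaryGroup (Fin 3) ℂ) × Finset (SliceFermiIdx Nf S) → ℂ)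
          =ᵐ[(sliceHaar S).prod (Measure.count : Measure (Finset (SliceFermiIdx Nf S)))]
          fun y => ∫ y', k y y' * φ y' ∂((sliceHaar S).prod (Measure.count : Measure (Finset (SliceFermiIdx Nf S))))) →
    ∀ (φ : Lp ℂ 2 ((sliceHaar S).prod (Measure.count : Measure (Finset (SliceFermiIdx Nf S))))) (lam : ℝ),
      lam ≠ 0 → φ ≠ 0 → A φ = (lam : ℂ) • φ →
      ∃ Ψ : SliceWave Nf S, Ψ ∈ transferCore Nf S ∧ fermionWeightForm mq Ψ Ψ ≠ 0 ∧
        fermionWeightForm mq Ψ Ψ = ((‖φ‖ ^ 2 : ℝ) : ℂ) ∧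
        transferForm β mq Ψ Ψ = (lam : ℂ) * fermionWeightForm mq Ψ Ψ ∧
        transferRayleigh β mq Ψ = lam := by
  intro Nf S _ β mq hm R hRc hR k hk A hA φ lam hlam hφ hAφ
  refine main_of_bondKernel
    (B := fun U U' => Matrix.of fun a c => ∫ g : TorusSite 3 S → (Matrix.specialUnitaryGroup (Fin 3) ℂ),
      (gaugeSliceKernel β U (gaugeTransform g U') : ℂ) * @fockGaugeAct Nf S _ g a c
        ∂(Measure.pi fun _ => haarProbability (Matrix.specialUnitaryGroup (Fin 3) ℂ)))
    hRc ?_ β mq ?_ ?_ k ?_ A hA φ lam hlam hφ hAφ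
  · intro a c
    simpa only [Matrix.of_apply] using stub_bondKernel_continuous Nf S β a c
  · intro h U U'
    exact bondKernel_gaugeTransform_left β h U U'
  · intro Ψ hΨ
    exact stub_rayleigh_of_invariant Nf S β mq hm R hRc hR Ψ hΨ
  · exact hk

end Summit.QuantumFields.QCD.Cruxes.StableActionBridge.TwistedTraceTransfer

end
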